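import Literature.AlgebraicGeometry.AbelianSchemes.AbelianSchemeOverZariskiGluing
import Literature.AlgebraicGeometry.AbelianSchemes.AbelianSchemeOverSectionsBaseChange
import HarnessLib

/-!
# Zariski descent of LEVEL STRUCTURES along a gluing datum for abelian schemes

Sequel of `AbelianSchemeOverZariskiGluingDatum` / `AbelianSchemeOverZariskiGluing` (cell hodgecm-mathlib, F-DAG
second hand (h7) «Zariski gluing of `S`-objects from a cocycle», FILE 4 = leaf (L); consumer F-8 (8c)/(8e)).  For a
gluing datum `𝔇 : ZariskiGluingDatum S` (charts `χᵢ : Aᵢ = Z ×_S Uᵢ → Z`, overlap schemes `Aᵢⱼ`) FILE 3b built the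
glued abelian scheme `𝔇.abelianScheme` on `Z → S`.  Here a family of level-`N` structures `φᵢ` on the `Aᵢ`
([MumfordFogartyKirwan1994, Def. 7.1]: `2g` sections, `N`-torsion, a basis of the `N`-torsion of every geometric
fibre), compatible on the overlaps through level structures `φᵢⱼ` on the `Aᵢⱼ` (the pull-back relation of level
structures, ★ `LevelStructure.IsBaseChangeVia`, along `κ₁`, `κ₂`) — a `LevelDatum` — is glued to a level-`N`
structure on the glued abelian scheme:

* §1 `IsBaseChangeVia.pushHomMulEquiv` — for a base-change square of group schemes `G : A' → A` over `g`, the map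
  on points `f ↦ f ≫ G` (FILE 3a `pushHom`) is a GROUP ISOMORPHISM `Hom_{S'}(T', A') ≃* Hom_S(T', A)`
  ([GortzWedhorn2020] Section (4.15): «`(G ×_S S')_{S'}(T) = G_S(T)`»); it carries restrictions of compatible
  sections to restrictions (`pushHom_restrict`);
* §2 the points of `𝔇.abelianScheme` multiply by the glued law (`hom_mul_eq`, `hom_one_eq`), so the chart
  restriction is a homomorphism (`resHom`); every field-valued point of `S` factors through a chart (`exists_fac`);
* §3 the glued sections `glueSection ℓ k ∈ Z(S)` (FILE 3a `glue` at `T = S`; compatibility `compat_sections` from the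
  section clauses of `φᵢⱼ`), their section clause `σᵢ(k) ≫ χᵢ = (Uᵢ → S) ≫ σ(k)` (`σ_left_comp_χ`), `N`-torsion
  (`glueSection_pow`, chartwise), and **`𝔇.levelStructure ℓ : 𝔇.abelianScheme.LevelStructure g N`** — the basis
  clauses hold at a geometric point `s` of `S` because `s` factors through some `Uᵢ`, over which the geometric fibre of
  `Z` IS that of `Aᵢ` (§1) and Mumford's sections `σ^a` correspond (★ `IsBaseChangeVia.sectionPow_comp`); finally
  **`isBaseChangeVia_levelStructure i : (ℓ.φ i).IsBaseChangeVia (𝔇.levelStructure ℓ) (𝔇.𝒰.f i) (𝔇.χ i)`**.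

No named fact, no `sorry`, no instance.  HC_CM is proved only modulo the printed citations until rung 0 closes; this
file discharges none of them.

## References
* [MumfordFogartyKirwan1994] D. Mumford, J. Fogarty, F. Kirwan, *Geometric Invariant Theory*, 3rd ed. (1994), Ch. 7
  §2 Def. 7.1 (p. 129) (level-`n` structure), Def. 7.2 (p. 129) (pull-back of families).
* [GortzWedhorn2020] U. Görtz, T. Wedhorn, *Algebraic Geometry I*, 2nd ed. (2020), Section (3.3) Prop. 3.5 (gluing of
  morphisms), Section (4.15) (p. 116) (group schemes on points; base change), Def. 4.42 (p. 116) (homomorphisms).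
-/

noncomputable section

universe u

open CategoryTheory CategoryTheory.Limits AlgebraicGeometry MonoidalCategory CartesianMonoidalCategory
open scoped MonObj

namespace Literature.AlgebraicGeometry.AbelianSchemes

namespace AbelianSchemeOver

/-! ### §1 The bijection on points of a base-change square -/

section PushHomEquiv

variable {S S' : Scheme.{u}} {A' : AbelianSchemeOver S'} {A : AbelianSchemeOver S} {g : S' ⟶ S}
  {G : A'.X.left ⟶ A.X.left}

/-- The inverse map on points of a base-change square `G : A' → A` over `g`: a point of `A` over `T' → S' → S` lifts
uniquely to a point of `A' = A ×_S S'` over `T'` (the cartesian square of `IsBaseChangeVia`).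
[cite: GortzWedhorn2020, Section (4.15) (p. 116)] -/
def IsBaseChangeVia.pullHom (h : A'.IsBaseChangeVia A g G) {T' : Over S'} (f : Over.mk (T'.hom ≫ g) ⟶ A.X) :
    T' ⟶ A'.X :=
  Over.homMk (h.snd.1.lift f.left T'.hom (Over.w f)) (h.snd.1.lift_snd _ _ _)

/-- `pullHom f` followed by `G` is `f`. [cite: GortzWedhorn2020, Section (4.15) (p. 116)] -/
theorem IsBaseChangeVia.pullHom_left_comp (h : A'.IsBaseChangeVia A g G) {T' : Over S'}
    (f : Over.mk (T'.hom ≫ g) ⟶ A.X) : (h.pullHom f).left ≫ G = f.left :=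
  h.snd.1.lift_fst _ _ _

/-- **`Hom_{S'}(T', A') ≃* Hom_S(T', A)` for a base-change square of group schemes** (`f ↦ f ≫ G`, inverse
`pullHom`; multiplicative by FILE 3a `pushHom_mul`): [GortzWedhorn2020] Section (4.15) «`(G ×_S S')_{S'}(T) = G_S(T)`»
as GROUPS. [cite: GortzWedhorn2020, Section (4.15) (p. 116) and Definition 4.42 (p. 116)] -/
def IsBaseChangeVia.pushHomMulEquiv (h : A'.IsBaseChangeVia A g G) (T' : Over S') :
    (T' ⟶ A'.X) ≃* (Over.mk (T'.hom ≫ g) ⟶ A.X) where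
  toFun := h.pushHom
  invFun := h.pullHom
  left_inv f := by
    ext
    exact h.snd.1.hom_ext (by rw [IsBaseChangeVia.pullHom_left_comp, IsBaseChangeVia.pushHom_left])
      (by erw [Over.w, Over.w])
  right_inv f := by
    ext
    rw [IsBaseChangeVia.pushHom_left, IsBaseChangeVia.pullHom_left_comp]
  map_mul' := h.pushHom_mul

/-- `pushHomMulEquiv` is `pushHom` on elements. [cite: GortzWedhorn2020, Section (4.15) (p. 116)] -/
@[simp]
theorem IsBaseChangeVia.pushHomMulEquiv_apply (h : A'.IsBaseChangeVia A g G) (T' : Over S') (f : T' ⟶ A'.X) :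
    h.pushHomMulEquiv T' f = h.pushHom f := rfl

/-- Compatible sections restrict compatibly: if `τ' ≫ G = g ≫ τ` then `pushHom (τ'(s')) = τ(s' ≫ g)` on every
field-valued point `s'` of `S'` — Mumford's «the images `σᵢ(s)`» under pull-back.
[cite: MumfordFogartyKirwan1994, Ch. 7 §2 Definition 7.2 (p. 129)] -/
theorem IsBaseChangeVia.pushHom_restrict (h : A'.IsBaseChangeVia A g G) {Ω : Type u} [Field Ω]
    (s' : Spec (.of Ω) ⟶ S') {τ' : A'.Sections} {τ : A.Sections} (hτ : τ'.left ≫ G = g ≫ τ.left) :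
    h.pushHom (A'.restrict s' τ') = A.restrict (s' ≫ g) τ := by
  ext
  rw [IsBaseChangeVia.pushHom_left, Over.comp_left, Category.assoc, hτ, Over.comp_left, Over.toUnit_left,
    Over.toUnit_left]
  rfl

end PushHomEquiv

namespace ZariskiGluingDatum

variable {S : Scheme.{u}} (𝔇 : ZariskiGluingDatum S)

/-! ### §2 Points of the glued abelian scheme vs the glued operations -/

/-- Points of the glued abelian scheme multiply by the glued product of FILE 3a (`μ = mul fst snd` and functoriality).
[cite: GortzWedhorn2020, Section (4.15) (p. 116)] -/
theorem hom_mul_eq {T : Over S} (f g : T ⟶ 𝔇.abelianScheme.X) : f * g = 𝔇.mul f g := by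
  rw [Hom.mul_def, mul_eq]
  erw [comp_mul', lift_fst, lift_snd]

/-- The unit point of the glued abelian scheme is the glued unit of FILE 3a. [cite: GortzWedhorn2020, Section (4.15) (p. 116)] -/
theorem hom_one_eq (T : Over S) : (1 : T ⟶ 𝔇.abelianScheme.X) = 𝔇.one T := by
  rw [Hom.one_def, one_eq]
  exact 𝔇.comp_one' _

/-- Restriction of points of the glued abelian scheme to the chart over `Uᵢ`, as a MONOID HOMOMORPHISM
`Hom_S(T, Z) →* Hom_{Uᵢ}(T ×_S Uᵢ, Aᵢ)`. [cite: GortzWedhorn2020, Section (4.15) (p. 116) and Definition 4.42 (p. 116)] -/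
def resHom (T : Over S) (i : 𝔇.𝒰.I₀) : (T ⟶ 𝔇.abelianScheme.X) →* (𝔇.chart T i ⟶ (𝔇.A i).X) where
  toFun f := 𝔇.res f i
  map_one' := by
    show 𝔇.res (1 : T ⟶ 𝔇.abelianScheme.X) i = 1
    rw [hom_one_eq, res_one]
  map_mul' f g := by
    show 𝔇.res (f * g) i = 𝔇.res f i * 𝔇.res g i
    rw [hom_mul_eq, res_mul]

/-- `resHom` is `res` on elements. [cite: GortzWedhorn2020, Section (4.15) (p. 116)] -/
@[simp]
theorem resHom_apply (T : Over S) (i : 𝔇.𝒰.I₀) (f : T ⟶ 𝔇.abelianScheme.X) : 𝔇.resHom T i f = 𝔇.res f i := rfl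

/-- Every field-valued point of `S` factors through a member of the open cover (`Spec Ω` is one point; open
immersions lift). [cite: GortzWedhorn2020, Section (3.3) Proposition 3.5] -/
theorem exists_fac {Ω : Type u} [Field Ω] (s : Spec (.of Ω) ⟶ S) :
    ∃ (i : 𝔇.𝒰.I₀) (s' : Spec (.of Ω) ⟶ 𝔇.𝒰.X i), s' ≫ 𝔇.𝒰.f i = s := by
  obtain ⟨i, y, hy⟩ := 𝔇.𝒰.exists_eq (s.base default)
  refine ⟨i, IsOpenImmersion.lift (𝔇.𝒰.f i) s ?_, IsOpenImmersion.lift_fac _ _ _⟩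
  rintro _ ⟨x, rfl⟩
  obtain rfl := Subsingleton.elim x default
  exact ⟨y, hy⟩

/-! ### §3 Gluing level structures -/

/-- **Zariski gluing datum for a level-`N` structure** on top of `𝔇`: level-`N` structures ([MumfordFogartyKirwan1994]
Def. 7.1) on the charts `Aᵢ` and on the overlap schemes `Aᵢⱼ`, related by the pull-back relation of level structures
(Def. 7.2; ★ `LevelStructure.IsBaseChangeVia`) along `κ₁`, `κ₂`. [cite: MumfordFogartyKirwan1994, Ch. 7 §2 Definition 7.1 (p. 129)]
[cite: MumfordFogartyKirwan1994, Ch. 7 §2 Definition 7.2 (p. 129)] -/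
structure LevelDatum (g N : ℕ) where
  /-- the level structure on each chart -/
  φ : ∀ i, (𝔇.A i).LevelStructure g N
  /-- the level structure on each double overlap -/
  φ₂ : ∀ i j, (𝔇.A₂ i j).LevelStructure g N
  /-- `φ₂ i j` is the pull-back of `φ i` along `κ₁` -/
  hφ₁ : ∀ i j, (φ₂ i j).IsBaseChangeVia (φ i) (pullback.fst (𝔇.𝒰.f i) (𝔇.𝒰.f j)) (𝔇.κ₁ i j)
  /-- `φ₂ i j` is the pull-back of `φ j` along `κ₂` -/
  hφ₂ : ∀ i j, (φ₂ i j).IsBaseChangeVia (φ j) (pullback.snd (𝔇.𝒰.f i) (𝔇.𝒰.f j)) (𝔇.κ₂ i j)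

section Level

variable {g N : ℕ} (ℓ : 𝔇.LevelDatum g N)

/-- Chartwise SECTIONS `τᵢ ∈ Aᵢ(Uᵢ)` which are the push-forwards of sections `τᵢⱼ ∈ Aᵢⱼ(Uᵢ ×_S Uⱼ)` along `κ₁`, `κ₂`
agree in `Z` on the double overlaps (the hypothesis of FILE 3a `glue` at `T = S`, via `compat_of`).
[cite: GortzWedhorn2020, Section (3.3) Proposition 3.5] [cite: MumfordFogartyKirwan1994, Ch. 7 §2 Definition 7.2 (p. 129)] -/
theorem compat_sections (τ : ∀ i, (𝔇.A i).Sections) (τ₂ : ∀ i j, (𝔇.A₂ i j).Sections)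
    (h₁ : ∀ i j, (τ₂ i j).left ≫ 𝔇.κ₁ i j = pullback.fst (𝔇.𝒰.f i) (𝔇.𝒰.f j) ≫ (τ i).left)
    (h₂ : ∀ i j, (τ₂ i j).left ≫ 𝔇.κ₂ i j = pullback.snd (𝔇.𝒰.f i) (𝔇.𝒰.f j) ≫ (τ j).left) (i j : 𝔇.𝒰.I₀) :
    pullback.fst (pullback.fst (𝟙_ (Over S)).hom (𝔇.𝒰.f i)) (pullback.fst (𝟙_ (Over S)).hom (𝔇.𝒰.f j)) ≫
        (toUnit (𝔇.chart (𝟙_ (Over S)) i) ≫ τ i).left ≫ 𝔇.χ i =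
      pullback.snd (pullback.fst (𝟙_ (Over S)).hom (𝔇.𝒰.f i)) (pullback.fst (𝟙_ (Over S)).hom (𝔇.𝒰.f j)) ≫
        (toUnit (𝔇.chart (𝟙_ (Over S)) j) ≫ τ j).left ≫ 𝔇.χ j := by
  refine 𝔇.compat_of (fun i => toUnit _ ≫ τ i) i j (toUnit _ ≫ τ₂ i j) ?_ ?_
  · refine 𝔇.hom_ext_χ _ _ ?_
    have e₁ : ((𝔇.hκ₁ i j).pushHom (toUnit (𝔇.chart₂ (𝟙_ (Over S)) i j) ≫ τ₂ i j)).left ≫ 𝔇.χ i =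
        𝔇.chart₂Base (𝟙_ (Over S)) i j ≫ pullback.fst _ _ ≫ (τ i).left ≫ 𝔇.χ i := by
      rw [IsBaseChangeVia.pushHom_left, Over.comp_left, Over.toUnit_left]
      erw [Category.assoc, Category.assoc, reassoc_of% (h₁ i j), Category.assoc]
      rfl
    have e₂ : (𝔇.pr₁ (𝟙_ (Over S)) i j ≫ toUnit _ ≫ τ i).left ≫ 𝔇.χ i =
        pullback.fst _ _ ≫ pullback.snd _ _ ≫ (τ i).left ≫ 𝔇.χ i := by
      rw [Over.comp_left, Over.comp_left, Over.toUnit_left]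
      erw [Category.assoc, Category.assoc]
    rw [e₁, e₂]
    exact (reassoc_of% (pullback.lift_fst _ _ _)) _
  · refine 𝔇.hom_ext_χ _ _ ?_
    have e₁ : ((𝔇.hκ₂ i j).pushHom (toUnit (𝔇.chart₂ (𝟙_ (Over S)) i j) ≫ τ₂ i j)).left ≫ 𝔇.χ j =
        𝔇.chart₂Base (𝟙_ (Over S)) i j ≫ pullback.snd _ _ ≫ (τ j).left ≫ 𝔇.χ j := by
      rw [IsBaseChangeVia.pushHom_left, Over.comp_left, Over.toUnit_left]
      erw [Category.assoc, Category.assoc, reassoc_of% (h₂ i j), Category.assoc]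
      rfl
    have e₂ : (𝔇.pr₂ (𝟙_ (Over S)) i j ≫ toUnit _ ≫ τ j).left ≫ 𝔇.χ j =
        pullback.snd _ _ ≫ pullback.snd _ _ ≫ (τ j).left ≫ 𝔇.χ j := by
      rw [Over.comp_left, Over.comp_left, Over.toUnit_left]
      erw [Category.assoc, Category.assoc]
    rw [e₁, e₂]
    exact (reassoc_of% (pullback.lift_snd _ _ _)) _

/-- The `k`-th GLUED SECTION `σ(k) ∈ Z(S)`: the chartwise sections `σᵢ(k)`, read on `S ×_S Uᵢ`, glued
([GortzWedhorn2020] Prop. 3.5). [cite: GortzWedhorn2020, Section (3.3) Proposition 3.5]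
[cite: MumfordFogartyKirwan1994, Ch. 7 §2 Definition 7.1 (p. 129)] -/
def glueSection (k : Fin g ⊕ Fin g) : 𝔇.abelianScheme.Sections :=
  𝔇.glue (fun i => toUnit _ ≫ (ℓ.φ i).σ k)
    (𝔇.compat_sections (fun i => (ℓ.φ i).σ k) (fun i j => (ℓ.φ₂ i j).σ k) (fun i j => (ℓ.hφ₁ i j).2 k)
      (fun i j => (ℓ.hφ₂ i j).2 k))

/-- The glued section restricts to `σᵢ(k)` on the chart over `Uᵢ`. [cite: GortzWedhorn2020, Section (3.3) Proposition 3.5] -/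
theorem res_glueSection (k : Fin g ⊕ Fin g) (i : 𝔇.𝒰.I₀) :
    𝔇.res (𝔇.glueSection ℓ k) i = toUnit _ ≫ (ℓ.φ i).σ k :=
  𝔇.res_glue _ _ i

/-- The SECTION CLAUSE of the pull-back relation: the chart section `σᵢ(k)` maps under `χᵢ` to `(Uᵢ → S) ≫ σ(k)`.
[cite: MumfordFogartyKirwan1994, Ch. 7 §2 Definition 7.2 (p. 129)] -/
theorem σ_left_comp_χ (k : Fin g ⊕ Fin g) (i : 𝔇.𝒰.I₀) :
    ((ℓ.φ i).σ k).left ≫ 𝔇.χ i = 𝔇.𝒰.f i ≫ (𝔇.glueSection ℓ k).left :=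
  𝔇.left_comp_χ_of_res_eq _ i _ (𝔇.res_glueSection ℓ k i)

/-- The glued sections are `N`-torsion (checked chartwise through the homomorphism `resHom`).
[cite: MumfordFogartyKirwan1994, Ch. 7 §2 Definition 7.1 (p. 129)] -/
theorem glueSection_pow (k : Fin g ⊕ Fin g) : 𝔇.glueSection ℓ k ^ N = 1 := by
  refine 𝔇.hom_ext_res _ _ fun i => ?_
  have h1 := map_pow (𝔇.resHom (𝟙_ (Over S)) i) (𝔇.glueSection ℓ k) N
  rw [resHom_apply, resHom_apply, res_glueSection, ← MonObj.comp_pow, (ℓ.φ i).pow_σ, MonObj.comp_one] at h1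
  rw [h1]
  exact (map_one (𝔇.resHom (𝟙_ (Over S)) i)).symm

/-- On field-valued points over `Uᵢ`, the restrictions of the glued Mumford sections `σ^a` are the push-forwards of the
restrictions of the chart's `σᵢ^a` (★ `IsBaseChangeVia.sectionPow_comp` + `pushHom_restrict`).
[cite: MumfordFogartyKirwan1994, Ch. 7 §2 Definition 7.2 (p. 129)] -/
theorem pushHom_restrict_sectionPow (i : 𝔇.𝒰.I₀) {Ω : Type u} [Field Ω] (s' : Spec (.of Ω) ⟶ 𝔇.𝒰.X i)
    (a : Fin g ⊕ Fin g → ZMod N) :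
    (𝔇.isBaseChangeVia_abelianScheme i).pushHom ((𝔇.A i).restrict s' ((𝔇.A i).sectionPow (ℓ.φ i).σ a)) =
      𝔇.abelianScheme.restrict (s' ≫ 𝔇.𝒰.f i) (𝔇.abelianScheme.sectionPow (𝔇.glueSection ℓ) a) :=
  (𝔇.isBaseChangeVia_abelianScheme i).pushHom_restrict s'
    ((𝔇.isBaseChangeVia_abelianScheme i).sectionPow_comp (fun k => 𝔇.σ_left_comp_χ ℓ k i) a)

/-- **The glued level-`N` structure** on the glued abelian scheme ([MumfordFogartyKirwan1994] Def. 7.1 for `Z → S`): the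
glued sections are `N`-torsion and form a basis of the `N`-torsion on every geometric fibre, because every geometric
point of `S` factors through some `Uᵢ`, over which the geometric fibre of `Z` IS that of `Aᵢ` as a group (the
isomorphism `pushHomMulEquiv` of §1) and the sections `σ^a` correspond. [cite: MumfordFogartyKirwan1994, Ch. 7 §2 Definition 7.1 (p. 129)] -/
def levelStructure : 𝔇.abelianScheme.LevelStructure g N where
  σ := 𝔇.glueSection ℓ
  pow_σ := 𝔇.glueSection_pow ℓ
  basis_injective Ω _ _ s := by
    obtain ⟨i, s', rfl⟩ := 𝔇.exists_fac s
    intro a b hab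
    dsimp only at hab
    rw [← pushHom_restrict_sectionPow, ← pushHom_restrict_sectionPow] at hab
    exact (ℓ.φ i).basis_injective s'
      (((𝔇.isBaseChangeVia_abelianScheme i).pushHomMulEquiv (Over.mk s')).injective hab)
  basis_surjective Ω _ _ s x hx := by
    obtain ⟨i, s', rfl⟩ := 𝔇.exists_fac s
    obtain ⟨y, hy'⟩ := ((𝔇.isBaseChangeVia_abelianScheme i).pushHomMulEquiv (Over.mk s')).surjective x
    have hy : y ^ N = 1 := ((𝔇.isBaseChangeVia_abelianScheme i).pushHomMulEquiv (Over.mk s')).injective (by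
      rw [map_pow, map_one]
      exact (congrArg (· ^ N) hy').trans hx)
    obtain ⟨a, ha⟩ := (ℓ.φ i).basis_surjective s' y hy
    exact ⟨a, (𝔇.pushHom_restrict_sectionPow ℓ i s' a).symm.trans
      ((congrArg (𝔇.isBaseChangeVia_abelianScheme i).pushHom ha).trans hy')⟩

/-- The sections of the glued level structure are the glued sections (by construction).
[cite: MumfordFogartyKirwan1994, Ch. 7 §2 Definition 7.1 (p. 129)] -/
@[simp]
theorem levelStructure_σ (k : Fin g ⊕ Fin g) : (𝔇.levelStructure ℓ).σ k = 𝔇.glueSection ℓ k := rfl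

/-- **Each chart level structure `φᵢ` is the pull-back of the glued one** along `Uᵢ → S` via `χᵢ` (★
`LevelStructure.IsBaseChangeVia`: the group-scheme clause is FILE 3b, the section clause is `σ_left_comp_χ`).
[cite: MumfordFogartyKirwan1994, Ch. 7 §2 Definition 7.2 (p. 129)] -/
theorem isBaseChangeVia_levelStructure (i : 𝔇.𝒰.I₀) :
    (ℓ.φ i).IsBaseChangeVia (𝔇.levelStructure ℓ) (𝔇.𝒰.f i) (𝔇.χ i) :=
  ⟨𝔇.isBaseChangeVia_abelianScheme i, fun k => 𝔇.σ_left_comp_χ ℓ k i⟩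

end Level

end ZariskiGluingDatum

end AbelianSchemeOver

end Literature.AlgebraicGeometry.AbelianSchemes

end
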